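import Summits.NavierStokesRegularity.OSWSelfSimilar.SheetRCentreOfRecord
import HarnessLib

/-!
# SHEET-ℝ frame: CLOSED FORMS of the velocity `𝒰Ω̄ = ∫₀^ξ HΩ̄`, the drift `d = ½ξ + a𝒰Ω̄` and the potential `V = 1 − HΩ̄ + λL²/(L² + ξ²)` of a frame
# centre — and of the centre of record

HONEST FRAMING (cell ns-blowup GROUP B / zone Z3, cases Z3-SR-CERT / Z3-SR-SPEC; 1-D MODEL certificate frame; not Euler/NS; «violates: none — MODEL»).
The interval sentences that remain hypotheses of `SheetRCertifiedProfileOfRecord.certifiedProfile_word_ofRecord` ((C1) pointwise datum `hC1`, the base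
solution operator `hS₀`, the (S1) Gårding datum `hS1`) are stated through `hilbertTransform centreOfRecord`, `∫₀^ξ hilbertTransform centreOfRecord`,
`drift (1/5) centreOfRecord` and `potential 8 4 centreOfRecord`.  For a frame centre `Ω = Σ_{i<N} d_i e_{i+1} + αL²T₂` all four are EXPLICIT elementary
functions of `θ = 2arctan(ξ/L)` and `ξ` (the tree's per-mode closed forms: `hilbertTransform_frame`, `integral_one_add_cos_mul_cos_cayleyAngle`
`∫₀^ξ(1 + cos θ)cos nθ = (L/n) sin nθ`, `hilbertTransform_farFieldT2`, `integral_hilbertTransform_farFieldT2` `∫₀^ξ HT₂ = −(2/π)arsinh(ξ/L)/√(L² + ξ²)`):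

* `integral_hilbertTransform_frameCentre` — `∫₀^ξ HΩ = −Σ d_i·(L/(i+1))·sin((i+1)θ) − αL²·(2/π)·arsinh(ξ/L)/√(L² + ξ²)`;
* `drift_frameCentre`, `potential_frameCentre` — the coefficients of the linearised operator `B_λ` in closed form;
* `…_centreOfRecord` — the same at `L = 8`, `N = 767`, the data of record, `a = 1/5`, `λ = 4`.
So every remaining hypothesis of the Z3-SR word is now a closed Lean `Prop` about explicit elementary functions with rational data — the shape an interval
engine (Taylor models in `θ`) could certify.  No definition, no named fact.  WHAT THIS IS NOT: not NS; no inequality is proved here.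
-/

noncomputable section

namespace Summit.NavierStokesRegularity.OSWSelfSimilar
namespace SheetRFrameCentreVelocity

open _root_.MeasureTheory _root_.Set _root_.Real Literature.Analysis.Fourier SheetRCayleySubstitution SheetRCayleyHilbert SheetRFarFieldT2
  SheetRCertificateAssembly SheetRFrameCentre SheetRCentreOfRecord
open scoped Topology

section Generic

variable {L : ℝ} (hL : 0 < L) (N : ℕ) (d : ℕ → ℝ) (α : ℝ)
include hL

/-- **`∫₀^ξ HΩ` in closed form** for a frame centre: `−Σ d_i (L/(i+1)) sin((i+1)θ(ξ)) − αL²·(2/π)·arsinh(ξ/L)/√(L² + ξ²)`. [folklore] -/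
theorem integral_hilbertTransform_frameCentre (ξ : ℝ) :
    ∫ s in (0 : ℝ)..ξ, hilbertTransform (frameCentre L N d α) s =
      -(∑ i ∈ Finset.range N, d i * (L / (i + 1 : ℕ) * sin ((i + 1 : ℕ) * (2 * arctan (ξ / L)))))
        + α * (L ^ 2 * -(2 / π * Real.arsinh (ξ / L) / √(L ^ 2 + ξ ^ 2))) := by
  have hL0 : L ≠ 0 := hL.ne'
  have hH : hilbertTransform (frameCentre L N d α) = fun x =>
      -(∑ i ∈ Finset.range N, d i * ((1 + cos (2 * arctan (x / L))) * cos ((i + 1 : ℕ) * (2 * arctan (x / L)))))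
        + α * (L ^ 2 * (2 / π * (x * Real.arsinh (x / L) / ((L ^ 2 + x ^ 2) * √(L ^ 2 + x ^ 2)) - (L ^ 2 + x ^ 2)⁻¹))) :=
    funext (hilbertTransform_frameCentre hL N d α)
  simp only [hH]
  -- integrability of the pieces (all continuous)
  have hci : ∀ i ∈ Finset.range N, IntervalIntegrable
      (fun x => d i * ((1 + cos (2 * arctan (x / L))) * cos ((i + 1 : ℕ) * (2 * arctan (x / L))))) volume 0 ξ :=
    fun i _ => ((contDiff_coframe L (i + 1) (k := 0)).continuous.const_mul (d i)).intervalIntegrable _ _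
  have hsum : IntervalIntegrable (fun x => ∑ i ∈ Finset.range N,
      d i * ((1 + cos (2 * arctan (x / L))) * cos ((i + 1 : ℕ) * (2 * arctan (x / L))))) volume 0 ξ :=
    (continuous_finsetSum _ fun i _ => (contDiff_coframe L (i + 1) (k := 0)).continuous.const_mul (d i)).intervalIntegrable _ _
  have hT : IntervalIntegrable (fun x => α * (L ^ 2 * (2 / π * (x * Real.arsinh (x / L) / ((L ^ 2 + x ^ 2) * √(L ^ 2 + x ^ 2))
      - (L ^ 2 + x ^ 2)⁻¹)))) volume 0 ξ :=
    (((continuous_hilbertTransform_farFieldT2 hL).const_mul (L ^ 2)).const_mul α).intervalIntegrable _ _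
  have hsum' : IntervalIntegrable (fun x => -(∑ i ∈ Finset.range N,
      d i * ((1 + cos (2 * arctan (x / L))) * cos ((i + 1 : ℕ) * (2 * arctan (x / L)))))) volume 0 ξ := hsum.neg
  rw [intervalIntegral.integral_add hsum' hT, intervalIntegral.integral_neg, intervalIntegral.integral_finsetSum hci,
    intervalIntegral.integral_const_mul, intervalIntegral.integral_const_mul]
  congr 2
  · refine Finset.sum_congr rfl fun i _ => ?_
    rw [intervalIntegral.integral_const_mul, integral_one_add_cos_mul_cos_cayleyAngle hL0 (Nat.succ_ne_zero i)]
  · have h := integral_hilbertTransform_farFieldT2 hL ξ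
    have hfun : (hilbertTransform fun y : ℝ => y / ((L ^ 2 + y ^ 2) * √(L ^ 2 + y ^ 2))) =
        fun x => 2 / π * (x * Real.arsinh (x / L) / ((L ^ 2 + x ^ 2) * √(L ^ 2 + x ^ 2)) - (L ^ 2 + x ^ 2)⁻¹) :=
      funext (hilbertTransform_farFieldT2 hL)
    rw [hfun] at h
    rw [h]

/-- **The drift in closed form**: `drift a Ω ξ = ξ/2 + a·∫₀^ξ HΩ` with the integral as above. [folklore] -/
theorem drift_frameCentre (a ξ : ℝ) :
    drift a (frameCentre L N d α) ξ = ξ / 2 + a * (-(∑ i ∈ Finset.range N, d i * (L / (i + 1 : ℕ) * sin ((i + 1 : ℕ) * (2 * arctan (ξ / L)))))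
        + α * (L ^ 2 * -(2 / π * Real.arsinh (ξ / L) / √(L ^ 2 + ξ ^ 2)))) := by
  rw [drift, integral_hilbertTransform_frameCentre hL N d α ξ]

/-- **The potential in closed form**: `potential L λ Ω ξ = 1 − HΩ(ξ) + λL²/(L² + ξ²)` with `HΩ` as in `hilbertTransform_frameCentre`. [folklore] -/
theorem potential_frameCentre (lam ξ : ℝ) :
    potential L lam (frameCentre L N d α) ξ =
      1 - (-(∑ i ∈ Finset.range N, d i * ((1 + cos (2 * arctan (ξ / L))) * cos ((i + 1 : ℕ) * (2 * arctan (ξ / L)))))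
        + α * (L ^ 2 * (2 / π * (ξ * Real.arsinh (ξ / L) / ((L ^ 2 + ξ ^ 2) * √(L ^ 2 + ξ ^ 2)) - (L ^ 2 + ξ ^ 2)⁻¹))))
        + lam * (L ^ 2 / (L ^ 2 + ξ ^ 2)) := by
  rw [potential, hilbertTransform_frameCentre hL N d α ξ]

end Generic

/-! ### The centre of record (`L = 8`, `N = 767`, `a = 1/5`, `λ = 4`) -/

/-- `∫₀^ξ HΩ̄` for the centre of record. [folklore] -/
theorem integral_hilbertTransform_centreOfRecord (ξ : ℝ) :
    ∫ s in (0 : ℝ)..ξ, hilbertTransform centreOfRecord s =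
      -(∑ i ∈ Finset.range 767, centreCoeff i * ((8:ℝ) / (i + 1 : ℕ) * sin ((i + 1 : ℕ) * (2 * arctan (ξ / 8)))))
        + centreAlpha2 * ((8:ℝ) ^ 2 * -(2 / π * Real.arsinh (ξ / 8) / √((8:ℝ) ^ 2 + ξ ^ 2))) :=
  integral_hilbertTransform_frameCentre (by norm_num) 767 centreCoeff centreAlpha2 ξ

/-- The drift `d = ½ξ + (1/5)𝒰Ω̄` of the linearisation at the centre of record, in closed form. [folklore] -/
theorem drift_centreOfRecord (ξ : ℝ) :
    drift (1 / 5) centreOfRecord ξ = ξ / 2 + 1 / 5 *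
      (-(∑ i ∈ Finset.range 767, centreCoeff i * ((8:ℝ) / (i + 1 : ℕ) * sin ((i + 1 : ℕ) * (2 * arctan (ξ / 8)))))
        + centreAlpha2 * ((8:ℝ) ^ 2 * -(2 / π * Real.arsinh (ξ / 8) / √((8:ℝ) ^ 2 + ξ ^ 2)))) :=
  drift_frameCentre (by norm_num) 767 centreCoeff centreAlpha2 (1 / 5) ξ

/-- The potential `V = 1 − HΩ̄ + 4·64/(64 + ξ²)` of the linearisation at the centre of record, in closed form. [folklore] -/
theorem potential_centreOfRecord (ξ : ℝ) :
    potential 8 4 centreOfRecord ξ =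
      1 - (-(∑ i ∈ Finset.range 767, centreCoeff i * ((1 + cos (2 * arctan (ξ / 8))) * cos ((i + 1 : ℕ) * (2 * arctan (ξ / 8)))))
        + centreAlpha2 * ((8:ℝ) ^ 2 * (2 / π * (ξ * Real.arsinh (ξ / 8) / (((8:ℝ) ^ 2 + ξ ^ 2) * √((8:ℝ) ^ 2 + ξ ^ 2)) - ((8:ℝ) ^ 2 + ξ ^ 2)⁻¹))))
        + 4 * ((8:ℝ) ^ 2 / ((8:ℝ) ^ 2 + ξ ^ 2)) :=
  potential_frameCentre (by norm_num) 767 centreCoeff centreAlpha2 4 ξ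

end SheetRFrameCentreVelocity
end Summit.NavierStokesRegularity.OSWSelfSimilar

end
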